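import Mathlib
import HarnessLib
import Summits.Langlands.Langlands.Theses.EisensteinGelfandKirillov
import Literature.NumberTheory.GaloisRepresentations.Pseudocharacter

/-!
# Route `EisensteinGelfandKirillov`, crux `ProModularOfGKBound` (stmt-Langlands-18273): vocabulary of
# the line `eisenstein-fern`

Route-posited objects (D-0016 `<Route><Crux>Defs`-type file; same convention as
`SkinnerWilesDefectOneReducibleOrdinaryProModularDefs.lean`) shared by the four registered stubs of the
checked skeleton `Cruxes/ProModularOfGKBound/Lines/eisenstein_fern.lean` (lead copy registered
2026-08-17 by `ledger skeleton check`, stubs `stub_seed`, `stub_evilBranch`, `stub_fern`,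
`stub_readout`) and by the crux file that will compose them.  NOTHING IS ASSERTED: every
`def … : Prop` below is a *statement* consumed only as (part of) the type of a stub theorem; the one
`Type`-valued abbreviation (`Pl`) and the one term (`heckeSinv`, an element of the tree's big Hecke
algebra `𝕋(𝒰)`) bundle EXISTING tree vocabulary and introduce no axiom.  Declared in the skeleton's
namespace `Summit.Langlands.Langlands.Cruxes.ProModularOfGKBound.EisensteinFern`, so that a landed stub
`theorem stub_<name> : <registered signature>` reads byte-identically to its registration (the lead's
skeleton is reshaped to import this file in place of its inline copies).

Objects (verbatim from the planner's checked skeleton, planner-cruxplan-stmt-Langlands-18273-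
eisenstein-fern-0, 2026-08-17; docstrings carry the mathematics; line card
`Cruxes/ProModularOfGKBound/Lines/eisenstein-fern.md`):

* `Pl F` — the finite places of `F`;
* `OnCommonComponent S ρ r` — `ρ` and `r` lie on one irreducible `p`-adic family of `2`-dimensional
  pseudocharacters of `Γ_F` unramified outside `S` (R^ps-free rendering of "same irreducible component
  of `Spec R^ps_S`", [cite: Chenevier2011, §1] / [cite: BellaicheChenevier2009, §1.4]);
* `IsFernPoint S hcpt ι r` — a good classical (cuspidal, L-algebraic regular, `φ`-generic at `p`,
  non-CM) point;
* `LocallyIrreducibleAbove p r` — no `Γ_{F_v}`-stable line at any `v ∣ p`;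
* `heckeSinv 𝒰 v hv` — the generator `[U t_{v,2}⁻¹ U] ∈ 𝕋(𝒰)`;
* `DenseHeckeFamily 𝒰 ρ` — a Zariski-dense Hecke family of tame level `𝒰` through `ρ` (the fern's
  output, [cite: Chenevier2011, Thm E and §3]).
-/

set_option linter.dupNamespace false
set_option autoImplicit false

noncomputable section

open scoped NumberField Polynomial
open IsDedekindDomain Filter Topology
open Literature.NumberTheory.GaloisRepresentations Literature.NumberTheory.Automorphic
open Literature.NumberTheory.Automorphic.BigHeckeGLn

namespace Summit.Langlands.Langlands.Cruxes.ProModularOfGKBound.EisensteinFern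

variable {F : Type} [Field F] [NumberField F] {p : ℕ} [Fact p.Prime]

/-- Finite places of the number field `F` (`HeightOneSpectrum (𝓞 F)`). [folklore] -/
abbrev Pl (F : Type) [Field F] [NumberField F] : Type := HeightOneSpectrum (𝓞 F)

/-- **`ρ` and `r` lie on a common irreducible component of the pseudo-deformation space unramified
outside `S`** (R^ps-free rendering): an irreducible `p`-adic family of `2`-dimensional pseudocharacters
of `Γ_F` — a compact Hausdorff Noetherian local integral domain `A` with a continuous pseudocharacter
`T : Γ_F → A` of dimension `2`, unramified outside `S` (every inertia group `I_𝔓`, `𝔓 ∣ v ∉ S`, acts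
trivially on `T`), specialising to `tr ρ` and to `tr r` at two continuous `ℚ̄_p`-points of `A`.
Intended `A = R^ps_{τ̄,S}/P` with its `𝔪`-adic topology (a component `V(P)` gives such an `A`;
conversely the universal property of `R^ps` on profinite local algebras maps `R^ps → A` with prime
kernel below both points). [cite: Chenevier2011, §1] -/
def OnCommonComponent (S : Set (Pl F)) (ρ r : FramedGaloisRep F (PadicAlgCl p) 2) : Prop :=
  ∃ (A : Type) (_ : CommRing A) (_ : IsDomain A) (_ : IsLocalRing A) (_ : IsNoetherianRing A)
    (_ : TopologicalSpace A) (_ : IsTopologicalRing A) (_ : CompactSpace A) (_ : T2Space A)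
    (T : ContinuousPseudocharacter (Field.absoluteGaloisGroup F) A 2)
    (x y : A →+* PadicAlgCl p),
    Continuous x ∧ Continuous y ∧
    (∀ v ∉ S, ∀ 𝔓 ∈ v.primesAbove, ∀ σ ∈ 𝔓.inertia (Field.absoluteGaloisGroup F),
      ∀ g : Field.absoluteGaloisGroup F, T (g * σ) = T g) ∧
    (∀ g, x (T g) = FramedRep.trace ρ g) ∧ (∀ g, y (T g) = FramedRep.trace r g)

/-- **`r` is a good classical (fern) point relative to `S`, `hcpt`, `ι`**: irreducible; Satake–Frobenius
compatible at every `v ∉ S` (hence unramified there) with a cuspidal `π` on `GL₂(𝔸_F)` that is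
L-ALGEBRAIC of REGULAR infinity type (the summit's normalisation: untwisted `SatakeFrobCompatibleAt`
is satisfiable only for L-algebraic `π`) and which at every `v ∣ p` is unramified with `φ`-generic
Satake parameter (`α ≠ β`, `α ≠ q_v β`, `β ≠ q_v α`); and NON-CM: `r|_{Γ_M}` irreducible for every
quadratic extension `M/F`. [folklore] -/
def IsFernPoint (S : Set (Pl F)) (hcpt : isCompact_glFiniteIntegralLevel 2 F) (ι : PadicAlgCl p ≃+* ℂ)
    (r : FramedGaloisRep F (PadicAlgCl p) 2) : Prop :=
  r.toGaloisRep.IsIrreducible ∧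
  (∃ π : CuspidalAutomorphicRepData 2 F hcpt, π.1.IsLAlgebraic ∧
    (∃ T : InfinityType F 2, π.1.HasInfinityType T ∧ T.IsRegular) ∧
    (∀ v ∉ S, Summit.Langlands.SatakeFrobCompatibleAt ι π.1 r v) ∧
    (∀ v : Pl F, ((p : ℕ) : 𝓞 F) ∈ v.asIdeal → ∃ α : Multiset ℂ, π.1.HasSatakeParamAt v α ∧
      α.Nodup ∧ ∀ a ∈ α, ∀ b ∈ α, a ≠ b → a ≠ (v.residueCard : ℂ) * b)) ∧
  (∀ (M : Type) [Field M] [NumberField M] [Algebra F M], Module.finrank F M = 2 →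
    (r.restrictField M).toGaloisRep.IsIrreducible)

/-- **`r` is locally irreducible at every place above `p`**: no `Γ_{F_v}`-stable line, i.e. in no frame
is `r|_{Γ_{F_v}}` upper triangular (both refinements of a crystalline such `r_v` are non-critical).
[folklore] -/
def LocallyIrreducibleAbove (p : ℕ) [Fact p.Prime] (r : FramedGaloisRep F (PadicAlgCl p) 2) : Prop :=
  ∀ v : Pl F, ((p : ℕ) : 𝓞 F) ∈ v.asIdeal →
    ¬ ∃ Q : GL (Fin 2) (PadicAlgCl p), ∀ σ, (Q⁻¹ * r.toLocal v σ * Q).val 1 0 = 0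

/-- The generator `S_v⁻¹ = [U t_{v,2}⁻¹ U] ∈ 𝕋(𝒰)` (the second family of `𝒰.heckeGenerators`), for
`v ∉ 𝒰.bad` [cite: GeeNewton2020, §2.1.3]. -/
def heckeSinv (𝒰 : TameLevel 2 F p) (v : Pl F) (hv : v ∉ 𝒰.bad) :
    CompletedCohomologyHeckeAlgebraGLn 𝒰 :=
  ⟨𝒰.heckeOperator ((heckeElement 2 F v 2)⁻¹),
    (Subring.closure 𝒰.heckeGenerators).le_topologicalClosure
      (Subring.subset_closure (Or.inr ⟨v, hv, rfl⟩))⟩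

/-- **A Zariski-dense Hecke family of level `𝒰` through `ρ`** (the fern's output, R^ps-free): a compact
Hausdorff integral domain `A` with elements `a v i` (`T_{v,i}`-eigenvalues of the family) and `b v`
(`S_v⁻¹`-eigenvalue), `v ∉ 𝒰.bad`; a continuous point `x : A → ℚ̄_p` at which `a v 1`, `q_v · a v 2`
become `tr ρ(σ)`, `det ρ(σ)` for every arithmetic Frobenius `σ` at `v`; and a family of continuous points
`pt k` with `⋂_k ker (pt k) = 0` (Zariski density) each of which IS a continuous Hecke eigensystem of
level `𝒰` with eigenvalues `pt k (a v i)`, `pt k (b v)`.  Intended: `A = R^ps_S/P_C`, `pt k` = the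
classical cuspidal level-`K^p` points of the component `C ∋ 𝔭_ρ` [cite: Chenevier2011, Thm E and §3]. -/
def DenseHeckeFamily (𝒰 : TameLevel 2 F p) (ρ : FramedGaloisRep F (PadicAlgCl p) 2) : Prop :=
  ∃ (A : Type) (_ : CommRing A) (_ : IsDomain A) (_ : TopologicalSpace A) (_ : IsTopologicalRing A)
    (_ : CompactSpace A) (_ : T2Space A)
    (a : Pl F → ℕ → A) (b : Pl F → A) (x : A →+* PadicAlgCl p) (κ : Type) (pt : κ → (A →+* PadicAlgCl p)),
    Continuous x ∧ (∀ k, Continuous (pt k)) ∧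
    (∀ z : A, (∀ k, pt k z = 0) → z = 0) ∧
    (∀ v ∉ 𝒰.bad, ∀ 𝔓 ∈ v.primesAbove, ∀ σ : Field.absoluteGaloisGroup F, IsArithFrobAt (𝓞 F) σ 𝔓 →
      x (a v 1) = FramedRep.trace ρ σ ∧
      (Ideal.absNorm v.asIdeal : PadicAlgCl p) * x (a v 2) = (ρ σ).val.det) ∧
    (∀ k, ∃ h : CompletedCohomologyHeckeAlgebraGLn 𝒰 →+* PadicAlgCl p, Continuous h ∧
      (∀ v ∉ 𝒰.bad, ∀ i : ℕ, h (𝒰.heckeT v i) = pt k (a v i)) ∧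
      (∀ (v : Pl F) (hv : v ∉ 𝒰.bad), h (heckeSinv 𝒰 v hv) = pt k (b v)))

/-! ## Unfolding / API lemmas (proved) -/

/-- `heckeSinv 𝒰 v hv` is, as an element of the product ring, the family of operators of `t_{v,2}⁻¹`.
[folklore] -/
theorem coe_heckeSinv (𝒰 : TameLevel 2 F p) (v : Pl F) (hv : v ∉ 𝒰.bad) :
    (heckeSinv 𝒰 v hv : 𝒰.bigEnd) = 𝒰.heckeOperator ((heckeElement 2 F v 2)⁻¹) := rfl

/-- `OnCommonComponent S` is symmetric in `(ρ, r)` (swap the two specialisations). [folklore] -/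
theorem onCommonComponent_symm : ∀ (F : Type) [Field F] [NumberField F] (p : ℕ) [Fact p.Prime] (S : Set (Pl F)) (ρ r : FramedGaloisRep F (PadicAlgCl p) 2), OnCommonComponent S ρ r → OnCommonComponent S r ρ := by
  intro F _ _ p _ S ρ r h
  obtain ⟨A, i₁, i₂, i₃, i₄, i₅, i₆, i₇, i₈, T, x, y, hx, hy, hT, hxT, hyT⟩ := h
  exact ⟨A, i₁, i₂, i₃, i₄, i₅, i₆, i₇, i₈, T, y, x, hy, hx, hT, hyT, hxT⟩

/-- `OnCommonComponent` is monotone in the exceptional set: a family unramified outside `S` is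
unramified outside any `S' ⊇ S`. [folklore] -/
theorem OnCommonComponent.mono {S S' : Set (Pl F)} (hSS' : S ⊆ S')
    {ρ r : FramedGaloisRep F (PadicAlgCl p) 2} (h : OnCommonComponent S ρ r) :
    OnCommonComponent S' ρ r := by
  obtain ⟨A, i₁, i₂, i₃, i₄, i₅, i₆, i₇, i₈, T, x, y, hx, hy, hT, hxT, hyT⟩ := h
  exact ⟨A, i₁, i₂, i₃, i₄, i₅, i₆, i₇, i₈, T, x, y, hx, hy, fun v hv => hT v fun h => hv (hSS' h),
    hxT, hyT⟩

/-- A place outside `𝒰.bad ⊇ S` is outside `S`: the form in which the composition feeds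
`stub_readout` (`ρ` unramified outside `S` and `S ⊆ 𝒰.bad` give `ρ` unramified outside `𝒰.bad`).
[folklore] -/
theorem isUnramifiedAt_of_subset_bad {S : Set (Pl F)} (𝒰 : TameLevel 2 F p)
    (ρ : FramedGaloisRep F (PadicAlgCl p) 2) (hSur : ∀ v ∉ S, ρ.IsUnramifiedAt v)
    (hS𝒰 : S ⊆ 𝒰.bad) : ∀ v ∉ 𝒰.bad, ρ.IsUnramifiedAt v :=
  fun v hv => hSur v fun hvS => hv (hS𝒰 hvS)

/-! ## Audit lemmas for the conclusion of `stub_fern` (`DenseHeckeFamily`): non-vacuity and consistency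
(wave 1 of lead a2, 2026-08-17; see the item's evidence `stub-fern-blocked.md`) -/

/-- A dense Hecke family of level `𝒰` yields a CONTINUOUS `ℚ̄_p`-valued eigensystem of the big Hecke
algebra `𝕋(𝒰)` — the non-constructible content of the conclusion of `stub_fern`.  On the way: the index
type `κ` is nonempty, since with `κ` empty the density clause `∀ z, (∀ k, pt k z = 0) → z = 0` forces
`1 = 0` in the domain `A` (no "empty family" junk inhabitant). [folklore] -/
theorem DenseHeckeFamily.exists_continuous_eigensystem {𝒰 : TameLevel 2 F p}
    {ρ : FramedGaloisRep F (PadicAlgCl p) 2} (h : DenseHeckeFamily 𝒰 ρ) :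
    ∃ h : CompletedCohomologyHeckeAlgebraGLn 𝒰 →+* PadicAlgCl p, Continuous h := by
  obtain ⟨A, i₁, i₂, i₃, i₄, i₅, i₆, a, b, x, κ, pt, hx, hpt, hinj, hρ, heig⟩ := h
  have hκ : Nonempty κ := by
    by_contra hκ
    have h10 : (1 : A) = 0 := hinj 1 fun k => absurd ⟨k⟩ hκ
    exact one_ne_zero h10
  obtain ⟨k⟩ := hκ
  obtain ⟨h, hh, -, -⟩ := heig k
  exact ⟨h, hh⟩

/-- `t_{v,0} = 1` (no uniformiser on the diagonal), hence `T_{v,0} = [U 1 U]`: the `i = 0` instance of the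
eigenvalue clause of `DenseHeckeFamily` is met by `a v 0 := 1` once `[U 1 U] = 1`. [folklore] -/
theorem heckeElement_zero (n : ℕ) (K : Type) [Field K] [NumberField K]
    (v : HeightOneSpectrum (𝓞 K)) : heckeElement n K v 0 = 1 := by
  unfold heckeElement
  have e : (fun k : Fin n => if k.val < 0 then uniformizerIdele K v (uniformizerAt v) else 1) = 1 := by
    funext k
    simp
  rw [e, map_one]

/-- In rank `2`, `t_{v,i} = t_{v,2}` for every `i ≥ 2` (`Fin 2` indices are `< 2 ≤ i`), so the clauses
`i ≥ 3` of `DenseHeckeFamily` repeat the clause `i = 2`. [folklore] -/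
theorem heckeElement_eq_of_two_le (K : Type) [Field K] [NumberField K]
    (v : HeightOneSpectrum (𝓞 K)) {i : ℕ} (hi : 2 ≤ i) :
    heckeElement 2 K v i = heckeElement 2 K v 2 := by
  unfold heckeElement
  congr 1
  funext k
  have hk : k.val < 2 := k.2
  rw [if_pos (lt_of_lt_of_le hk hi), if_pos hk]

/-- Hence `T_{v,i} = T_{v,2}` in `𝕋(𝒰)` for `i ≥ 2` (rank `2`). [folklore] -/
theorem heckeT_eq_of_two_le (𝒰 : TameLevel 2 F p) (v : HeightOneSpectrum (𝓞 F)) {i : ℕ}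
    (hi : 2 ≤ i) : 𝒰.heckeT v i = 𝒰.heckeT v 2 := by
  classical
  by_cases hv : v ∈ 𝒰.bad
  · simp [TameLevel.heckeT, hv]
  · exact Subtype.ext (by rw [𝒰.coe_heckeT hv i, 𝒰.coe_heckeT hv 2, heckeElement_eq_of_two_le F v hi])

/-- Enlarging the bad set of a tame level to any finite `T ⊇ 𝒰.bad` (same level subgroup) — the
construction inside `exists_isPadicallyAutomorphic_bad_eq` of the Negative knowledge file, as a definition.
[folklore] -/
def tameLevelOfSupset (𝒰 : TameLevel 2 F p) (T : Set (HeightOneSpectrum (𝓞 F))) (hT : T.Finite)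
    (hle : 𝒰.bad ⊆ T) : TameLevel 2 F p where
  subgroup := 𝒰.subgroup
  bad := T
  bad_finite := hT
  mem_bad_of_mem v hv := hle (𝒰.mem_bad_of_mem v hv)
  isOpen := 𝒰.isOpen
  isCompact := 𝒰.isCompact
  le_glFiniteIntegralLevel := 𝒰.le_glFiniteIntegralLevel
  ofLocal_mem v hv g hg := 𝒰.ofLocal_mem v (fun h => hv (hle h)) g hg
  mul_ofLocal_inv_mem v hv u hu := 𝒰.mul_ofLocal_inv_mem v (fun h => hv (hle h)) u hu

/-- The bad set of `tameLevelOfSupset 𝒰 T hT hle` is `T` (definitional). [folklore] -/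
@[simp] theorem tameLevelOfSupset_bad (𝒰 : TameLevel 2 F p) (T : Set (HeightOneSpectrum (𝓞 F)))
    (hT : T.Finite) (hle : 𝒰.bad ⊆ T) : (tameLevelOfSupset 𝒰 T hT hle).bad = T := rfl

/-- The level clause `S ⊆ 𝒰.bad` of the conclusion of `stub_fern` is always achievable: for every finite
`S` containing the places above `p` there is a tame level with `bad = S` (full level `GL₂(𝒪̂_F)` with
enlarged bad set).  So the obstruction is `DenseHeckeFamily`, never the level. [folklore] -/
theorem exists_tameLevel_bad_eq : ∀ (F : Type) [Field F] [NumberField F] (p : ℕ) [Fact p.Prime] (S : Set (Pl F)), S.Finite → (∀ v : Pl F, ((p : ℕ) : 𝓞 F) ∈ v.asIdeal → v ∈ S) → ∃ 𝒰 : TameLevel 2 F p, 𝒰.bad = S :=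
  fun F _ _ p _ S hS hSp => ⟨tameLevelOfSupset (TameLevel.full 2 F p) S hS fun v hv => hSp v hv, rfl⟩

end Summit.Langlands.Langlands.Cruxes.ProModularOfGKBound.EisensteinFern

end
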